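import Summits.ResolutionOfSingularities.ResolutionOfSingularities.Theorems.PurelyInseparableDim4ResConeAlternation
import Summits.ResolutionOfSingularities.ResolutionOfSingularities.Theorems.PurelyInseparableDim4ResConeLettersInPair
import HarnessLib
import HarnessLib.Audit.Tags

/-!
# Purely inseparable four-folds — the TAME CONE AT A CONSTANT-`d` STEP, XI: the FIXED-PAIR theorem — on a
# constant-`(d, e_G ≤ 2)` tail whose changes are satellites keeping the pre-run component, the chart letters after
# the first change lie in ONE PAIR `{a, b}` (idea-4 g3 memo E2-WINDOW (A1): «a⁺ b⁺ a⁺ b⁺ … inside a FIXED pair»)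

[OURS · counted 0 · cell `res-dim4-pi` · desk WORD #66 (2) (K2(p) lower-band lane, owner p-12 g2) · seat
res-dim4-p-5 g2 (algebraic half) with res-dim4-typ-1 g2 (`letters_in_pair`, the combinatorial half) · K lane crit-4 g2.]
Nothing here proves K2(p), `NoIsolatedTrap p p` or resolution of singularities in dimension ≥ 4 / characteristic `p`.

Setting (`…ResConeAlternation`): isolated above-floor witnessed chain `(c, j, b)`, `x^{r₀} ∣ F₀`, constant shade and
constant `finrank (resVertex (c k)) = e ≤ 2` for `k ≥ k₀`.  Hypotheses on the tail's moves (both automatic for PURE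
CORNER tails, and the shape of idea-4's classes A∞/C∞):
(H1) every change of chart letter is a SATELLITE change (`j (k+1) ≠ j k → b (k+1) (j k) = 0`);
(H2) the change closing a run KEEPS the component of the letter that preceded the run (`b (c+1) (j a) = 0` for
consecutive change times `a < c`).

* `chain_consecutive_changes_return` — under (H1)(H2), consecutive change times `a < c` satisfy `j (c+1) = j a`
  (`…Alternation.chain_return_of_kept`);
* **`chain_letters_in_pair`** — hence, if `k₁ ≥ k₀` is a change time, `j k ∈ {j k₁, j (k₁+1)}` for all `k ≥ k₁`
  (typ-1 g2's `letters_in_pair`);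
* `chain_letters_in_pair_of_pure_corner` — the pure-corner special case (`b (k+1) = 0` for `k ≥ k₀`).

[cite: CossartJannsenSaito2020, Thm. 3.10(4), Thm. 3.14, Thm. 9.3]
bears_on: LADDER-RESOLUTION:D157-DOOR2 (res-dim4-pi · K2(p) = `RidgeBudget.NoAboveFloorTrap p p`, lower band).
Supports stmt-ResolutionOfSingularities-16155 (helper).
-/

set_option linter.dupNamespace false -- mandated namespace of this single-conjunct summit

noncomputable section

namespace Summit.ResolutionOfSingularities.ResolutionOfSingularities.Theorems.PIDim4

namespace ResCone

open MvPolynomial Finset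
open Literature.AlgebraicGeometry.Resolution
open Literature.AlgebraicGeometry.Resolution.CentreBlowup
open Literature.AlgebraicGeometry.Resolution.Hauser2010
open Literature.AlgebraicGeometry.Resolution.HauserPerlega2019
open PointBlowup (polarMap additiveSubspace direction)

variable {K : Type} [Field K]

section FixedPair

variable (p : ℕ) [Fact p.Prime] [DecidableEq K]

/-- **Consecutive changes return** under (H1) «changes are satellites» and (H2) «the closing change keeps the pre-run
component». [OURS] [cite: CossartJannsenSaito2020, Thm. 3.14] -/
theorem chain_consecutive_changes_return {c : ℕ → State K} {j : ℕ → Fin 4} {b : ℕ → Fin 4 → K}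
    (hc : ∀ k, IsIsolated p (c k).F ∧ Step0 p (c k) (c (k + 1))) (hw : FreeTail.IsWitnessedChain p c j b)
    (hr0 : ∀ e ∈ (c 0).F.support, (c 0).r ≤ e) (hfloor : ∀ k, ordZero (c k).F ≠ p) {k₀ : ℕ} {d : ℕ∞}
    (hshade : ∀ k, k₀ ≤ k → (c k).shade = d) {e : ℕ}
    (he : ∀ k, k₀ ≤ k → Module.finrank K (resVertex (c k)) = e) (he2 : e ≤ 2)
    (H1 : ∀ k, k₀ ≤ k → j (k + 1) ≠ j k → b (k + 1) (j k) = 0)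
    (H2 : ∀ a c' : ℕ, k₀ ≤ a → a < c' → j (a + 1) ≠ j a → (∀ τ, a < τ → τ ≤ c' → j τ = j (a + 1)) →
      j (c' + 1) ≠ j c' → b (c' + 1) (j a) = 0)
    {a c' : ℕ} (ha : k₀ ≤ a) (hac : a < c') (hcha : j (a + 1) ≠ j a)
    (hrun : ∀ τ, a < τ → τ ≤ c' → j τ = j (a + 1)) (hchc : j (c' + 1) ≠ j c') : j (c' + 1) = j a :=
  chain_return_of_kept p hc hw hr0 hfloor hshade he he2 ha hac ⟨hcha, H1 a ha hcha⟩ hrun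
    ⟨hchc, H1 c' (by omega) hchc⟩ (H2 a c' ha hac hcha hrun hchc)

/-- **THE FIXED-PAIR THEOREM**: on a constant-`(d, e_G ≤ 2)` tail satisfying (H1)(H2), if `k₁ ≥ k₀` is a change time
then every later chart letter is `j k₁` or `j (k₁+1)` — the letters read `a⁺ b⁺ a⁺ b⁺ …` inside ONE pair. [OURS]
[cite: CossartJannsenSaito2020, Thm. 3.10(4), Thm. 3.14, Thm. 9.3] -/
theorem chain_letters_in_pair {c : ℕ → State K} {j : ℕ → Fin 4} {b : ℕ → Fin 4 → K}
    (hc : ∀ k, IsIsolated p (c k).F ∧ Step0 p (c k) (c (k + 1))) (hw : FreeTail.IsWitnessedChain p c j b)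
    (hr0 : ∀ e ∈ (c 0).F.support, (c 0).r ≤ e) (hfloor : ∀ k, ordZero (c k).F ≠ p) {k₀ : ℕ} {d : ℕ∞}
    (hshade : ∀ k, k₀ ≤ k → (c k).shade = d) {e : ℕ}
    (he : ∀ k, k₀ ≤ k → Module.finrank K (resVertex (c k)) = e) (he2 : e ≤ 2)
    (H1 : ∀ k, k₀ ≤ k → j (k + 1) ≠ j k → b (k + 1) (j k) = 0)
    (H2 : ∀ a c' : ℕ, k₀ ≤ a → a < c' → j (a + 1) ≠ j a → (∀ τ, a < τ → τ ≤ c' → j τ = j (a + 1)) →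
      j (c' + 1) ≠ j c' → b (c' + 1) (j a) = 0)
    {k₁ : ℕ} (hk : k₀ ≤ k₁) (hchg : j (k₁ + 1) ≠ j k₁) :
    ∀ k, k₁ ≤ k → j k = j k₁ ∨ j k = j (k₁ + 1) :=
  letters_in_pair j k₁ hchg fun a c' ha hac hcha hrun hchc =>
    chain_consecutive_changes_return p hc hw hr0 hfloor hshade he he2 H1 H2 (by omega) hac hcha hrun hchc

/-- **Pure-corner tails**: if every chart point of the tail is the chart origin (`b (k+1) = 0` for `k ≥ k₀`), (H1) and
(H2) hold trivially, so after the first change the letters lie in a fixed pair. [OURS]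
[cite: CossartJannsenSaito2020, Thm. 3.14] -/
theorem chain_letters_in_pair_of_pure_corner {c : ℕ → State K} {j : ℕ → Fin 4} {b : ℕ → Fin 4 → K}
    (hc : ∀ k, IsIsolated p (c k).F ∧ Step0 p (c k) (c (k + 1))) (hw : FreeTail.IsWitnessedChain p c j b)
    (hr0 : ∀ e ∈ (c 0).F.support, (c 0).r ≤ e) (hfloor : ∀ k, ordZero (c k).F ≠ p) {k₀ : ℕ} {d : ℕ∞}
    (hshade : ∀ k, k₀ ≤ k → (c k).shade = d) {e : ℕ}
    (he : ∀ k, k₀ ≤ k → Module.finrank K (resVertex (c k)) = e) (he2 : e ≤ 2)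
    (hcorner : ∀ k, k₀ ≤ k → b (k + 1) = 0) {k₁ : ℕ} (hk : k₀ ≤ k₁) (hchg : j (k₁ + 1) ≠ j k₁) :
    ∀ k, k₁ ≤ k → j k = j k₁ ∨ j k = j (k₁ + 1) :=
  chain_letters_in_pair p hc hw hr0 hfloor hshade he he2
    (fun k hk' _ => by rw [hcorner k hk']; rfl)
    (fun a c' ha hac _ _ _ => by rw [hcorner c' (by omega)]; rfl) hk hchg

end FixedPair

end ResCone

end Summit.ResolutionOfSingularities.ResolutionOfSingularities.Theorems.PIDim4

end
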